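import Summits.Ventures.PercRepro.S1KillCells
import Summits.Ventures.PercRepro.S1Nullity
import Summits.Ventures.PercRepro.S1NullityChain

/-!
# PercRepro — A CELL BY THE KILL LEVER AND THE NULLITY LEVER (p2, gen 22; SUBCLAIM-S1 §6.7)

The coloop-free case of a cell with BOTH levers on the actual triangle count `t = s₃`: the `Y`-side gains the kill
of `mk t` triangles (S1KillCells), and the `U`-side loses the independent four-sets with `≥ k = d + 1 − r` points
outside the nullity set `S` of `r = rr t` greedily chosen triangles (S1Nullity, S1NullityChain): at least
`exclCount n m k − S − (t − r)(n − 3)` of them, `m = |E ∖ S| ∈ [n − 3r, n − 3]`. One kernel line per `(t, m)`.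

* `levelCount_le_cellUB` — the cell form's `U`-bound on the level count `#{B : r(B) = 4, |B| ≤ d}` itself;
* `killnullOK` — the kernel condition with the kill credit on the `Y`-side and the exclusion credit on the `U`-side;
* `weighted_of_killnullOK` — its meaning on a capped core;
* **`rls_of_ladder_case_killnull`** — one ladder case (`c` coloops) from the kernel lines.
Axioms: standard.
-/

open scoped Matroid

namespace PercRepro

namespace S1

open Set

variable {α : Type}

/-- **The cell form's `U`-bound on the level count**: `7560·#{B ⊆ E : r(B) = 4, |B| ≤ d} ≤ cellUB` (the `U`-half of
`cell_bounds` without the top-count step). -/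
theorem levelCount_le_cellUB (M : Matroid α) [M.Finite] (p d P S S5 : ℕ) (hd4 : 4 ≤ d) (hR : M.eRank = (p : ℕ∞))
    (hn : M.E.ncard = p + d)
    (hfree : ∀ e ∈ M.E, ∃ A ⊆ M.E \ {e}, e ∉ M.closure A ∧ e ∉ M.closure ((M.E \ {e}) \ A))
    (hP : {C : Set α | M.IsCircuit C ∧ C.ncard = 3}.ncard ≤ P) (hS : {C : Set α | M.IsCircuit C ∧ C.ncard = 4}.ncard ≤ S)
    (hS5 : {C : Set α | M.IsCircuit C ∧ C.ncard = 5}.ncard ≤ S5) (hp : 5 ≤ p) :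
    7560 * {B : Set α | B ⊆ M.E ∧ M.eRk B = 4 ∧ B.ncard ≤ d}.ncard ≤ cellUB p d P S S5 := by
  unfold cellUB
  simp only [CoreRegimes.chooseF_eq]
  classical
  have hL : ∀ e ∈ M.E, ¬ M.IsLoop e := ThmN.not_isLoop_of_free M hfree
  have hs : ∀ e ∈ M.E, ∀ f ∈ M.E, e ≠ f → M.eRk {e, f} = 2 := by
    intro e he f hf hef
    have h2 : (2 : ℕ∞) ≤ M.eRk {e, f} :=
      ThmN.two_le_eRk_of_two_le_ncard_of_free M hfree (pair_subset he hf) (by rw [ncard_pair hef])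
    have h3 : M.eRk {e, f} ≤ 2 := by
      have := M.eRk_le_encard {e, f}
      rwa [encard_pair hef] at this
    exact le_antisymm h3 h2
  have hcirc : ∀ C, M.IsCircuit C → 3 ≤ C.encard := ThmN.three_le_encard_of_circuit M hL hs
  have hline : ∀ L ⊆ M.E, M.eRk L ≤ 2 → L.ncard ≤ 3 := by
    intro L hL' hr
    have := ThmN.ncard_add_one_le_two_pow_of_eRk_le M hL hfree 2 L hL' hr
    omega
  have hplane : ∀ P ⊆ M.E, M.eRk P ≤ 3 → P.ncard ≤ 6 := fun P hP hr =>
    ThmN.ncard_le_six_of_eRk_le_three_of_free M hfree hP hr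
  have hten : ∀ X ⊆ M.E, M.eRk X ≤ 4 → X.ncard ≤ 10 := fun X hX hr =>
    ThmN.ncard_le_ten_of_eRk_le_four_of_free M hfree hX hr
  have hd : M.E.encard = M.eRank + d := by
    rw [hR, ← M.ground_finite.cast_ncard_eq, hn]
    push_cast
    ring
  set s3 := {C : Set α | M.IsCircuit C ∧ C.ncard = 3}.ncard with hs3
  set s4 := {C : Set α | M.IsCircuit C ∧ C.ncard = 4}.ncard with hs4
  set s5 := {C : Set α | M.IsCircuit C ∧ C.ncard = 5}.ncard with hs5
  have hb3 : s3 ≤ min (min (d * (d + 1) / 2) ((d * d + 6 - 3 * d) / 2)) P := by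
    have h := two_mul_ncard_triangles_le M (fun L hL hr => hline L hL hr.le) hd
    have h' : 2 * s3 ≤ d * (d + 1) := h
    have h2 := two_mul_ncard_triangles_add_three_mul_le_of_four_le M
      (fun L hL hr => hline L hL hr.le) hplane hd4 hd
    have h2' : 2 * s3 + 3 * d ≤ d * d + 6 := h2
    refine le_min (le_min ?_ ?_) hP
    · rw [Nat.le_div_iff_mul_le (by norm_num)]; omega
    · rw [Nat.le_div_iff_mul_le (by norm_num)]; omega
  have hb4 : s4 ≤ min (min (min ((d + 3).choose 4) (d * (d + 1) * (d + 2) / 3)) (fourCircuitBound d)) S := by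
    refine le_min (le_min (le_min (ncard_circuits_four_le M hd) ?_) (ncard_fourCircuits_le_fourCircuitBound M hfree hd)) hS
    have h := three_mul_ncard_four_circuits_le M hline hplane hd
    have h' : 3 * s4 ≤ d * (d + 1) * (d + 2) := h
    rw [Nat.le_div_iff_mul_le (by norm_num)]
    omega
  have hb5 : s5 ≤ min ((d + 4).choose 5) S5 := le_min (ncard_circuits_five_le M hd) hS5
  have hU2 : 7560 * {B : Set α | B ⊆ M.E ∧ M.eRk B = 4 ∧ B.ncard ≤ d}.ncard +
      7560 * (s3 * (M.E.ncard - 3) + s4) ≤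
      7560 * M.E.ncard.choose 4 +
      RSK d * (s3 * (M.E.ncard - 3).choose 2 + s4 * (M.E.ncard - 4) + s5) +
      (RBab d - RSK d) * (s3 * (min (5 * d) M.E.ncard - 3).choose 2 + s4 * (min (5 * d) M.E.ncard - 4) + s5) +
      Kab d := by
    rcases Nat.lt_or_ge d 7 with h6 | h7
    · rw [RBab_of_le_six (by omega), Kab_of_le_seven (by omega)]
      exact ncard_eRk_eq_four_ncard_le_le_AB6 M hcirc hline hplane hten hd (by omega)
    rcases Nat.lt_or_ge d 8 with h7' | h8
    · rw [RBab_of_eq_seven (by omega), Kab_of_le_seven (by omega)]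
      exact ncard_eRk_eq_four_ncard_le_le_AB7 M hcirc hline hplane hten hd (by omega)
    · rw [RBab_of_eight_le h8, Kab_of_eight_le h8, Nat.add_zero]
      exact ncard_eRk_eq_four_ncard_le_le_L1 M hcirc hline hplane hten hd
  have hU3 := ncard_eRk_eq_ncard_le_le_split_joint' M 4 10 6 (by norm_num) hcirc hten
    (fun X hX hr => hplane X hX (by simpa using hr)) hd
  rw [sum_Icc_three_five' (fun k => {C : Set α | M.IsCircuit C ∧ C.ncard = k}.ncard),
    sum_Icc_three_five' (fun k => {C : Set α | M.IsCircuit C ∧ C.ncard = k}.ncard)] at hU3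
  rw [hn] at hU2 hU3
  set m := min (5 * d) (p + d) with hm
  set s3B := min (min (d * (d + 1) / 2) ((d * d + 6 - 3 * d) / 2)) P with hs3B
  set s4B := min (min (min ((d + 3).choose 4) (d * (d + 1) * (d + 2) / 3)) (fourCircuitBound d)) S with hs4B
  set s5B := min ((d + 4).choose 5) S5 with hs5B
  set piAll := s3 * (p + d - 3).choose 2 + s4 * (p + d - 4) + s5 with hpiAll
  set piS0 := s3 * (m - 3).choose 2 + s4 * (m - 4) + s5 with hpiS0
  set piAllB := s3B * (p + d - 3).choose 2 + s4B * (p + d - 4) + s5B with hpiAllB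
  set piS0B := s3B * (m - 3).choose 2 + s4B * (m - 4) + s5B with hpiS0B
  have hpiAll_le : piAll ≤ piAllB := by
    rw [hpiAll, hpiAllB]; gcongr
  have hpiS0_le : piS0 ≤ piS0B := by
    rw [hpiS0, hpiS0B]; gcongr
  set sigs := ∑ j ∈ Finset.range (d - 5 + 1), Nat.choose 2 j with hsigs
  set sig := ∑ j ∈ Finset.range (d - 5 + 1), Nat.choose 5 j with hsig
  set A3 := RSK d * (p + d - 3).choose 2 + (RBab d - RSK d) * (m - 3).choose 2 with hA3
  set A4 := RSK d * (p + d - 4) + (RBab d - RSK d) * (m - 4) with hA4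
  set c5 := RSK d + (RBab d - RSK d) with hc5
  set c3 := A3 - 7560 * (p + d - 3) with hc3
  set c4 := A4 - 7560 with hc4
  have hRSK : 7560 ≤ RSK d := Nat.le_add_right _ _
  have hA3ge : 7560 * (p + d - 3) ≤ A3 := by
    have h1 : p + d - 3 ≤ (p + d - 3).choose 2 := le_choose_two _ (by omega)
    calc 7560 * (p + d - 3) ≤ RSK d * (p + d - 3).choose 2 := Nat.mul_le_mul hRSK h1
      _ ≤ A3 := Nat.le_add_right _ _
  have hA4ge : 7560 ≤ A4 := by
    calc 7560 = 7560 * 1 := by ring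
      _ ≤ RSK d * (p + d - 4) := Nat.mul_le_mul hRSK (by omega)
      _ ≤ A4 := Nat.le_add_right _ _
  have hA3eq : A3 = c3 + 7560 * (p + d - 3) := (Nat.sub_add_cancel hA3ge).symm
  have hA4eq : A4 = c4 + 7560 := (Nat.sub_add_cancel hA4ge).symm
  have hident : RSK d * piAll + (RBab d - RSK d) * piS0 = A3 * s3 + A4 * s4 + c5 * s5 := by
    rw [hpiAll, hpiS0, hA3, hA4, hc5]; ring
  set UB := min (7560 * (p + d).choose 4 + c3 * s3B + c4 * s4B + c5 * s5B + Kab d)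
    (7560 * ((p + d).choose 4 + sigs * piAllB + (sig - sigs) * piS0B)) with hUB
  have hUBle : 7560 * {B : Set α | B ⊆ M.E ∧ M.eRk B = 4 ∧ B.ncard ≤ d}.ncard ≤ UB := by
    refine le_min ?_ ?_
    · have hL : 7560 * {B : Set α | B ⊆ M.E ∧ M.eRk B = 4 ∧ B.ncard ≤ d}.ncard + 7560 * (s3 * (p + d - 3) + s4) ≤
          7560 * (p + d).choose 4 + (A3 * s3 + A4 * s4 + c5 * s5) + Kab d := by
        rw [← hident]
        have e : 7560 * (p + d).choose 4 + (RSK d * piAll + (RBab d - RSK d) * piS0) + Kab d =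
            7560 * (p + d).choose 4 + RSK d * piAll + (RBab d - RSK d) * piS0 + Kab d := by ring
        rw [e]
        exact hU2
      rw [hA3eq, hA4eq] at hL
      have hL' : 7560 * {B : Set α | B ⊆ M.E ∧ M.eRk B = 4 ∧ B.ncard ≤ d}.ncard ≤
          7560 * (p + d).choose 4 + (c3 * s3 + c4 * s4 + c5 * s5) + Kab d := by
        have e : 7560 * (p + d).choose 4 + ((c3 + 7560 * (p + d - 3)) * s3 + (c4 + 7560) * s4 + c5 * s5) + Kab d =
            7560 * (p + d).choose 4 + (c3 * s3 + c4 * s4 + c5 * s5) + Kab d + 7560 * (s3 * (p + d - 3) + s4) := by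
          ring
        rw [e] at hL
        omega
      calc 7560 * {B : Set α | B ⊆ M.E ∧ M.eRk B = 4 ∧ B.ncard ≤ d}.ncard
          ≤ 7560 * (p + d).choose 4 + (c3 * s3 + c4 * s4 + c5 * s5) + Kab d := hL'
        _ ≤ 7560 * (p + d).choose 4 + c3 * s3B + c4 * s4B + c5 * s5B + Kab d := by
            have h3 := Nat.mul_le_mul_left c3 hb3
            have h4 := Nat.mul_le_mul_left c4 hb4
            have h5 := Nat.mul_le_mul_left c5 hb5
            omega
    · calc 7560 * {B : Set α | B ⊆ M.E ∧ M.eRk B = 4 ∧ B.ncard ≤ d}.ncard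
          ≤ 7560 * ((p + d).choose 4 + sigs * piAll + (sig - sigs) * piS0) := Nat.mul_le_mul_left _ hU3
        _ ≤ 7560 * ((p + d).choose 4 + sigs * piAllB + (sig - sigs) * piS0B) := by gcongr
  exact hUBle

/-- **The kernel condition with both credits**: the kill `A'` on the `Y`-side and the exclusion `X` on the `U`-side —
`phiNum·cellUB + phiDen·(R34 + 7560·B') ≤ phiDen·(Ysum + 7560·A') + phiNum·7560·X`. -/
def killnullOK (p0 p d P S S5 A' B' X : ℕ) : Bool :=
  decide ((2 ^ (p0 + 4) - 2 * ∑ u ∈ Finset.range 5, CoreRegimes.chooseF (p0 + 4) u) * cellUB p d P S S5 +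
    CoreRegimes.chooseF (p0 + 4) 4 * (cellR34 p d P S S5 + 7560 * B') ≤
    CoreRegimes.chooseF (p0 + 4) 4 * (cellYsum p d + 7560 * A') +
    (2 ^ (p0 + 4) - 2 * ∑ u ∈ Finset.range 5, CoreRegimes.chooseF (p0 + 4) u) * (7560 * X))

/-- **What `killnullOK` means**: on the capped core `N` with the kill family `𝒯` (size-`k` circuits pairwise covering
`≥ 5` points) and an exclusion of `X ≤ #{B : |B| = 4, r(B) = 4, kk ≤ |B ∖ S|}` independent four-sets (`S` of nullity
`≥ r`, `d + 1 ≤ kk + r`), `Φ(p0, 4)·#U_N + B ≤ #Y_N + A`. -/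
theorem weighted_of_killnullOK (N : Matroid α) [N.Finite] (p0 p d P S S5 A B X : ℕ) (hd4 : 4 ≤ d)
    (hR : N.eRank = (p : ℕ∞)) (hn : N.E.ncard = p + d)
    (hfree : ∀ e ∈ N.E, ∃ Z ⊆ N.E \ {e}, e ∉ N.closure Z ∧ e ∉ N.closure ((N.E \ {e}) \ Z))
    (hP : {C : Set α | N.IsCircuit C ∧ C.ncard = 3}.ncard ≤ P) (hS : {C : Set α | N.IsCircuit C ∧ C.ncard = 4}.ncard ≤ S)
    (hS5 : {C : Set α | N.IsCircuit C ∧ C.ncard = 5}.ncard ≤ S5)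
    (hp : 5 ≤ p) (hp0 : 5 ≤ p0) (k : ℕ) (hkp : k ≤ p) (𝒯 : Finset (Set α))
    (h𝒯 : ∀ C ∈ 𝒯, N.IsCircuit C ∧ C.ncard = k) (hpair : ∀ C ∈ 𝒯, ∀ C' ∈ 𝒯, C ≠ C' → 5 ≤ (C ∪ C').ncard)
    {Sn : Set α} (hSn : Sn ⊆ N.E) {r kk : ℕ} (hν : N.eRk Sn + (r : ℕ∞) ≤ (Sn.ncard : ℕ∞)) (hkk : d + 1 ≤ kk + r)
    (hX : X ≤ {B : Set α | B ⊆ N.E ∧ B.ncard = 4 ∧ N.eRk B = 4 ∧ kk ≤ (B \ Sn).ncard}.ncard)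
    (hok : killnullOK p0 p d P S S5 (A + 𝒯.card * (p + d - k).choose (p - k))
      (B + 𝒯.card.choose 2 * (p + d - 5).choose (p - 5)) X = true) :
    phiK p0 4 * (Matroid.topCount N p 4 : ℚ) + B ≤ (Matroid.midCount N p 4 : ℚ) + A := by
  have hd : N.E.encard = N.eRank + d := by
    rw [hR, ← N.ground_finite.cast_ncard_eq, hn]
    push_cast
    ring
  have hlevel := levelCount_le_cellUB N p d P S S5 hd4 hR hn hfree hP hS hS5 hp
  have hexcl := topCount_add_excl_le N hR hd hn hd4 hSn hν hkk
  have hYB := cellYsum_kill_le N p d P S S5 hd4 hR hn hfree hP hS hS5 hp k hkp 𝒯 h𝒯 hpair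
  unfold killnullOK at hok
  simp only [CoreRegimes.chooseF_eq] at hok
  have hok' := of_decide_eq_true hok
  set phiNum := 2 ^ (p0 + 4) - 2 * ∑ u ∈ Finset.range 5, (p0 + 4).choose u with hphiNum
  set phiDen := (p0 + 4).choose 4 with hphiDen
  set UB := cellUB p d P S S5
  set R34 := cellR34 p d P S S5
  set Ysum := cellYsum p d
  set T := Matroid.topCount N p 4
  set Y := Matroid.midCount N p 4
  set Z := {B : Set α | B ⊆ N.E ∧ B.ncard = 4 ∧ N.eRk B = 4 ∧ kk ≤ (B \ Sn).ncard}.ncard with hZ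
  set L := {B : Set α | B ⊆ N.E ∧ N.eRk B = 4 ∧ B.ncard ≤ d}.ncard with hL
  set KA := 𝒯.card * (p + d - k).choose (p - k) with hKA
  set KB := 𝒯.card.choose 2 * (p + d - 5).choose (p - 5) with hKB
  -- `7560·T + 7560·X ≤ UB`
  have hUX : 7560 * T + 7560 * X ≤ UB := by
    have h1 : T + X ≤ L := by omega
    calc 7560 * T + 7560 * X = 7560 * (T + X) := by ring
      _ ≤ 7560 * L := Nat.mul_le_mul_left _ h1
      _ ≤ UB := hlevel
  have h1 : phiNum * (7560 * T) + phiNum * (7560 * X) ≤ phiNum * UB := by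
    calc phiNum * (7560 * T) + phiNum * (7560 * X) = phiNum * (7560 * T + 7560 * X) := by ring
      _ ≤ phiNum * UB := Nat.mul_le_mul_left _ hUX
  have h2 : phiDen * (Ysum + 7560 * KA) ≤ phiDen * (7560 * Y + R34 + 7560 * KB) := Nat.mul_le_mul_left _ hYB
  have hchain : phiNum * (7560 * T) + phiDen * (7560 * B) ≤ phiDen * (7560 * Y) + phiDen * (7560 * A) := by
    have e1 : phiDen * (R34 + 7560 * (B + KB)) = phiDen * R34 + phiDen * (7560 * B) + phiDen * (7560 * KB) := by ring
    have e2 : phiDen * (Ysum + 7560 * (A + KA)) = phiDen * Ysum + phiDen * (7560 * A) + phiDen * (7560 * KA) := by ring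
    have e3 : phiDen * (7560 * Y + R34 + 7560 * KB) = phiDen * (7560 * Y) + phiDen * R34 + phiDen * (7560 * KB) := by
      ring
    have e4 : phiDen * (Ysum + 7560 * KA) = phiDen * Ysum + phiDen * (7560 * KA) := by ring
    rw [e1, e2] at hok'
    rw [e3, e4] at h2
    omega
  -- to `ℚ`
  have hsum : 2 * ∑ u ∈ Finset.range 5, (p0 + 4).choose u ≤ 2 ^ (p0 + 4) := by
    have := sum_Ioo_choose_add_four p0 hp0
    omega
  have hphiNumQ : (phiNum : ℚ) = 2 ^ (p0 + 4) - 2 * ∑ u ∈ Finset.range 5, ((p0 + 4).choose u : ℚ) := by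
    rw [hphiNum, Nat.cast_sub hsum]
    push_cast
    ring
  have hΦ := phiK_four_mul_choose_eq p0 hp0
  rw [← hphiNumQ] at hΦ
  have hDenPos : (0 : ℚ) < (phiDen : ℚ) := by
    rw [hphiDen]; exact_mod_cast Nat.choose_pos (by omega)
  have hchainQ : (phiNum : ℚ) * (7560 * (T : ℚ)) + (phiDen : ℚ) * (7560 * (B : ℚ)) ≤
      (phiDen : ℚ) * (7560 * (Y : ℚ)) + (phiDen : ℚ) * (7560 * (A : ℚ)) := by
    have h : ((phiNum * (7560 * T) + phiDen * (7560 * B) : ℕ) : ℚ) ≤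
        ((phiDen * (7560 * Y) + phiDen * (7560 * A) : ℕ) : ℚ) := by exact_mod_cast hchain
    push_cast at h
    linarith
  have hkey : (phiK p0 4 * (T : ℚ) + (B : ℚ)) * (phiDen : ℚ) ≤ ((Y : ℚ) + (A : ℚ)) * (phiDen : ℚ) := by
    have e : (phiK p0 4 * (T : ℚ) + (B : ℚ)) * (phiDen : ℚ) =
        (phiK p0 4 * (phiDen : ℚ)) * (T : ℚ) + (phiDen : ℚ) * (B : ℚ) := by ring
    rw [e, hphiDen, hΦ, ← hphiDen]
    nlinarith [hchainQ]
  exact le_of_mul_le_mul_right hkey hDenPos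

/-- The exclusion credit of a kernel line: `exclCount n m k − S − (t − r)·(n − 3)` (truncated). -/
def exclX (n m k S t r : ℕ) : ℕ := exclCount n m k - S - (t - r) * (n - 3)

/-- **ONE LADDER CASE WITH BOTH LEVERS**: a finite `e`-free core of rank `p0 = p + c` (`p ≥ 5`) on `n = p0 + d` points
(`d ≥ 4`) with EXACTLY `c` coloops satisfies `RLS` at `(p0, 4)` once: at `t = s₃ = 0` the plain line `ladderOK`; at
`t ∈ [1, P]` with `rr t = 0` the kill line (`mk t` triangles); at `t` with `rr t = r ≥ 1` (`(r − 1)·r < 2t`,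
`2 ≤ d + 1 − r ≤ 4`) the kill-and-exclusion line for every `m = |E ∖ S| ∈ [n′ − 3r, n′ − 3]` (`n′ = p + d`). -/
theorem rls_of_ladder_case_killnull (M : Matroid α) [M.Finite] {p0 p c d n : ℕ} (hp0 : p0 = p + c) (hnd : n = p0 + d)
    (hR : M.eRank = (p0 : ℕ∞)) (hn : M.E.ncard = n)
    (hfree : ∀ e ∈ M.E, ∃ A ⊆ M.E \ {e}, e ∉ M.closure A ∧ e ∉ M.closure ((M.E \ {e}) \ A))
    (hc : M.coloops.ncard = c) (hp : 5 ≤ p) (hd4 : 4 ≤ d) {P S S5 : ℕ}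
    (hP : min ((p + d) * TriangleCap.cq3 (d - 1) / (p + d - 3)) (TriangleCap.cq3 d) ≤ P)
    (hS : (p + d) * ThmN.avgChain16 (d - 1) / (p + d - 4) ≤ S)
    (hS5 : (p + d) * avgChain5b (d - 1) / (p + d - 5) ≤ S5)
    (mk rr : ℕ → ℕ) (hmk : ∀ t ∈ Finset.Icc 1 P, 1 ≤ mk t ∧ mk t ≤ t)
    (hrr : ∀ t ∈ Finset.Icc 1 P, rr t = 0 ∨
      (1 ≤ rr t ∧ rr t ≤ d ∧ (rr t - 1) * rr t < 2 * t ∧ 2 ≤ d + 1 - rr t ∧ d + 1 - rr t ≤ 4))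
    (hzero : ladderOK p0 p d 0 S S5 (∑ j ∈ Finset.range c, 2 ^ (n - 1 - j))
      (∑ j ∈ Finset.range c, w3plus (n - 1 - j)) = true)
    (hok0 : ∀ t ∈ Finset.Icc 1 P, rr t = 0 →
      killnullOK p0 p d t S S5 ((∑ j ∈ Finset.range c, 2 ^ (n - 1 - j)) + mk t * (p + d - 3).choose (p - 3))
        ((∑ j ∈ Finset.range c, w3plus (n - 1 - j)) + (mk t).choose 2 * (p + d - 5).choose (p - 5)) 0 = true)
    (hok : ∀ t ∈ Finset.Icc 1 P, 1 ≤ rr t → ∀ m ∈ Finset.Icc (p + d - 3 * rr t) (p + d - 3),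
      killnullOK p0 p d t S S5 ((∑ j ∈ Finset.range c, 2 ^ (n - 1 - j)) + mk t * (p + d - 3).choose (p - 3))
        ((∑ j ∈ Finset.range c, w3plus (n - 1 - j)) + (mk t).choose 2 * (p + d - 5).choose (p - 5))
        (exclX (p + d) m (d + 1 - rr t) S t (rr t)) = true) :
    ThmN.RLS M p0 4 := by
  subst hp0
  have hR' : M.eRank = ((p + c : ℕ) : ℕ∞) := hR
  obtain ⟨N, hNfin, hNR, hNn, hNcol, hNfree, hNtop, hNmid⟩ := ladder_exact c M p hR' (by omega) (by omega) hfree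
  have hNn' : N.E.ncard = p + d := by omega
  have hNcol0 : N.coloops = ∅ := by
    have h0 : N.coloops.ncard = 0 := by omega
    exact (Set.ncard_eq_zero (N.ground_finite.subset N.coloops_subset_ground)).1 h0
  have hNd : N.E.encard = N.eRank + ((d - 1 + 1 : ℕ) : ℕ∞) := by
    rw [hNR, ← N.ground_finite.cast_ncard_eq, hNn', show d - 1 + 1 = d by omega]
    push_cast
    ring
  have hNd' : N.E.encard = N.eRank + (((d - 1 : ℕ) : ℕ∞) + 1) := by rw [hNd, Nat.cast_succ]
  have hNdd : N.E.encard = N.eRank + ((d : ℕ) : ℕ∞) := by rw [hNd, show d - 1 + 1 = d by omega]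
  have hP' : {C : Set α | N.IsCircuit C ∧ C.ncard = 3}.ncard ≤ P :=
    (le_min (ncard_triangles_le_of_coloopFree N hNfree hNd hNcol0 hNn' (by omega))
      (TriangleCap.core_ncard_triangles_le_cq3 N hNfree hNdd)).trans hP
  have hS' := (ncard_fourCircuits_le_of_coloopFree N hNfree hNd' hNcol0 hNn' (by omega)).trans hS
  have hS5' := (ncard_fiveCircuits_le_of_coloopFree N hNfree hNd' hNcol0 hNn' (by omega)).trans hS5
  -- the core facts of `N`
  have hL : ∀ e ∈ N.E, ¬ N.IsLoop e := ThmN.not_isLoop_of_free N hNfree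
  have hs : ∀ e ∈ N.E, ∀ f ∈ N.E, e ≠ f → N.eRk {e, f} = 2 := by
    intro e he f hf hef
    have h2 : (2 : ℕ∞) ≤ N.eRk {e, f} :=
      ThmN.two_le_eRk_of_two_le_ncard_of_free N hNfree (pair_subset he hf) (by rw [ncard_pair hef])
    have h3 : N.eRk {e, f} ≤ 2 := by
      have := N.eRk_le_encard {e, f}
      rwa [encard_pair hef] at this
    exact le_antisymm h3 h2
  have hcirc : ∀ C, N.IsCircuit C → 3 ≤ C.encard := ThmN.three_le_encard_of_circuit N hL hs
  have hC1 : ∀ L ⊆ N.E, N.eRk L = 2 → L.ncard ≤ 3 := by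
    intro L hL' hr
    have := ThmN.ncard_add_one_le_two_pow_of_eRk_le N hL hNfree 2 L hL' hr.le
    omega
  set t := {C : Set α | N.IsCircuit C ∧ C.ncard = 3}.ncard with ht
  set A := ∑ j ∈ Finset.range c, 2 ^ (n - 1 - j) with hA
  set B := ∑ j ∈ Finset.range c, w3plus (n - 1 - j) with hB
  -- the weighted inequality on `N`
  have hw : phiK (p + c) 4 * (Matroid.topCount N p 4 : ℚ) + B ≤ (Matroid.midCount N p 4 : ℚ) + A := by
    rcases Nat.eq_zero_or_pos t with h0 | hpos
    · exact weighted_of_ladderOK N (p + c) p d 0 S S5 A B hd4 hNR hNn' hNfree (by rw [← ht, h0]) hS' hS5' hp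
        (by omega) hzero
    · have htI : t ∈ Finset.Icc 1 P := Finset.mem_Icc.2 ⟨hpos, hP'⟩
      obtain ⟨hm1, hmt⟩ := hmk t htI
      obtain ⟨𝒯, h𝒯card, h𝒯mem⟩ := exists_finset_of_le_ncard hm1 (hmt.trans (le_of_eq ht))
      have hpair : ∀ C ∈ 𝒯, ∀ C' ∈ 𝒯, C ≠ C' → 5 ≤ (C ∪ C').ncard := fun C hC C' hC' hne =>
        five_le_ncard_union_of_triangles N hC1 (h𝒯mem C hC) (h𝒯mem C' hC') hne
      rcases hrr t htI with hr0 | ⟨hr1, hrd, hrt, hk2, hk4⟩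
      · -- the kill line
        refine weighted_of_killnullOK N (p + c) p d t S S5 A B 0 hd4 hNR hNn' hNfree le_rfl hS' hS5' hp (by omega) 3
          (by omega) 𝒯 (fun C hC => h𝒯mem C hC) hpair (Sn := ∅) (Set.empty_subset _) (r := 0) (kk := d + 1)
          (by simp) (by omega) (Nat.zero_le _) ?_
        rw [h𝒯card]
        exact hok0 t htI hr0
      · -- the kill-and-exclusion line
        have hrt' : (rr t - 1) * rr t < 2 * (ThmN.triangles N).ncard := hrt
        obtain ⟨Sn, hSnE, hSncard, hSnν, hSnout⟩ := exists_nullity_set N hC1 (rr t) hrt'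
        have hSnout' : {C : Set α | N.IsCircuit C ∧ C.ncard = 3 ∧ ¬ C ⊆ Sn}.ncard + rr t ≤ t := hSnout
        -- `Sn` contains a triangle, so `|Sn| ≥ 3`
        have hSn3 : 3 ≤ Sn.ncard := by
          by_contra hlt
          push Not at hlt
          have hall : {C : Set α | N.IsCircuit C ∧ C.ncard = 3 ∧ ¬ C ⊆ Sn} =
              {C : Set α | N.IsCircuit C ∧ C.ncard = 3} := by
            ext C
            simp only [Set.mem_setOf_eq]
            constructor
            · rintro ⟨h1, h2, -⟩; exact ⟨h1, h2⟩
            · rintro ⟨h1, h2⟩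
              refine ⟨h1, h2, fun hCS => ?_⟩
              have := Set.ncard_le_ncard hCS (N.ground_finite.subset hSnE)
              omega
          rw [hall, ← ht] at hSnout'
          omega
        set m := (N.E \ Sn).ncard with hm
        have hmE : m + Sn.ncard = N.E.ncard := Set.ncard_sdiff_add_ncard_of_subset hSnE N.ground_finite
        have hmI : m ∈ Finset.Icc (p + d - 3 * rr t) (p + d - 3) := Finset.mem_Icc.2 ⟨by omega, by omega⟩
        have hX : exclX (p + d) m (d + 1 - rr t) S t (rr t) ≤
            {B : Set α | B ⊆ N.E ∧ B.ncard = 4 ∧ N.eRk B = 4 ∧ d + 1 - rr t ≤ (B \ Sn).ncard}.ncard := by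
          have h := excl_ge_all N hcirc Sn hk2 hk4
          rw [hNn', ← hm] at h
          unfold exclX
          have h2 : {C : Set α | N.IsCircuit C ∧ C.ncard = 3 ∧ ¬ C ⊆ Sn}.ncard * (p + d - 3) ≤ (t - rr t) * (p + d - 3) :=
            Nat.mul_le_mul_right _ (by have := hSnout'; omega)
          omega
        refine weighted_of_killnullOK N (p + c) p d t S S5 A B _ hd4 hNR hNn' hNfree le_rfl hS' hS5' hp (by omega) 3
          (by omega) 𝒯 (fun C hC => h𝒯mem C hC) hpair hSnE (r := rr t) (kk := d + 1 - rr t) hSnν (by omega) hX ?_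
        rw [h𝒯card]
        exact hok t htI hr1 m hmI
  rw [ThmN.RLS_iff, hNtop]
  rw [hn] at hNmid
  have hmidQ : ((Matroid.midCount N p 4 : ℕ) : ℚ) + ((∑ j ∈ Finset.range c, 2 ^ (n - 1 - j) : ℕ) : ℚ) ≤
      ((Matroid.midCount M (p + c) 4 : ℕ) : ℚ) + ((∑ j ∈ Finset.range c, w3plus (n - 1 - j) : ℕ) : ℚ) := by
    exact_mod_cast hNmid
  linarith

end S1

end PercRepro
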